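import Summits.BirchSwinnertonDyer.BirchSwinnertonDyer.Theses.SignedLowerHalves
import Mathlib.NumberTheory.ModularForms.CongruenceSubgroups

/-!
# EGSketch-g8 (bsd-idea-13 g8, crux idea `p3-onesign-mu-sarithmetic-generation`, item stmt-BirchSwinnertonDyer-19002)

Statements only (Props), elaborating over existing declarations; NOTHING is proved here. See `EG-REDUCTION-g8.md`
and the sorry-free abstract lemma `EGCosetLemma.lean` in the crux directory.
-/

set_option linter.dupNamespace false

noncomputable section

open scoped Classical MatrixGroups ModularForm

namespace Summit.BirchSwinnertonDyer.BirchSwinnertonDyer.Cruxes.KobayashiMainConjectureSmallImage.EGCoset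

open CongruenceSubgroup Literature.NumberTheory.EllipticCurves Literature.NumberTheory.EllipticCurves.Rank1Residual
  Literature.NumberTheory.EllipticCurves.ModularForms
  Literature.NumberTheory.EllipticCurves.Kobayashi2003 Literature.NumberTheory.EllipticCurves.GreenbergVatsal2000

/-- `S_p ⊆ Γ₀(N)`: matrices whose lower-right entry is `± p^k` (equivalently: whose cusp `γ·0` has `p`-power denominator). -/
def pPowerCuspSet (N p : ℕ) : Set SL(2, ℤ) :=
  {γ | γ ∈ Gamma0 N ∧ ∃ k : ℕ, ((γ : Matrix (Fin 2) (Fin 2) ℤ) 1 1 = (p : ℤ) ^ k ∨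
                                 (γ : Matrix (Fin 2) (Fin 2) ℤ) 1 1 = -((p : ℤ) ^ k))}

/-- `Γ′ ⊆ Γ₀(N)`: matrices whose lower-right entry mod `N` lies in `⟨±1, p⟩ ⊆ (ℤ/N)^×`. -/
def gammaPrimeSet (N p : ℕ) : Set SL(2, ℤ) :=
  {γ | γ ∈ Gamma0 N ∧ ∃ k : ℕ, (((γ : Matrix (Fin 2) (Fin 2) ℤ) 1 1 : ℤ) : ZMod N) = (p : ZMod N) ^ k ∨
                                 (((γ : Matrix (Fin 2) (Fin 2) ℤ) 1 1 : ℤ) : ZMod N) = -((p : ZMod N) ^ k)}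

/-- **LEMMA′(N,p)** (first lemma of the line, the generation form (★★)): the `p`-power-cusp elements generate `Γ′`.
Claimed provable from Venkataramana 1994 / Vaserstein 1972 (finite index of `⟨U(𝔮),V(𝔮)⟩` in `SL₂(ℤ[1/p])`), Mennicke 1967 /
Serre 1970 (CSP for `SL₂(ℤ[1/p])`), an explicit `SL₂(ℤ/M)` computation, and `EGCoset.eq_closure_bigCellSet`. -/
def LemmaPrime (N p : ℕ) : Prop :=
  (Subgroup.closure (pPowerCuspSet N p) : Set SL(2, ℤ)) = gammaPrimeSet N p

/-- **LEMMA′(N,p), homomorphism form**: a character of `Γ₀(N)` (values in any commutative group) that kills `S_p` kills `Γ′`. -/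
def LemmaPrimeHom (N p : ℕ) : Prop :=
  ∀ (A : Type) [CommGroup A] (ψ : Gamma0 N →* A),
    (∀ γ : Gamma0 N, (γ : SL(2, ℤ)) ∈ pPowerCuspSet N p → ψ γ = 1) →
    ∀ γ : Gamma0 N, (γ : SL(2, ℤ)) ∈ gammaPrimeSet N p → ψ γ = 1

/-- **THEOREM A as a target** (the `p = 3` specialisation of `stub_muOneSign_ns` with the image / CM / semistability hypotheses
DROPPED): for every elliptic `W/ℚ` with good reduction at `3` and `a₃ = 0`, one of Pollack's `L₃^±` of its newform has unit content.
Claimed to follow from `LemmaPrime N 3` + the modular-symbol identities of EG-REDUCTION-g8.md §4 + `pollack_exists_plusMinusPAdicLFunction`. -/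
def MuOneSignAtThree : Prop :=
  ∀ (W : WeierstrassCurve ℚ) [W.IsElliptic] [W.IsGloballyMinimal],
    (haveI : Fact (3 : ℕ).Prime := ⟨Nat.prime_three⟩; W.HasGoodReductionAtPrime 3) → W.frobeniusTrace 3 = 0 →
    ∀ [NeZero (W.conductorNorm ℤ)] (f : CuspForm (Gamma0 (W.conductorNorm ℤ)) 2),
    IsNewformOf W f → haveI : Fact (3 : ℕ).Prime := ⟨Nat.prime_three⟩;
      ∃ (ε₀ : ℤˣ) (L₀ : IwasawaAlgebra 3), IsSignedPAdicLFunction f 3 ε₀ L₀ ∧ HasUnitContent L₀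

/-- Sanity: THEOREM A implies the `p = 3` slice of the stub (hypotheses of the stub only weaken the claim). -/
theorem stub_muOneSign_ns_three_of (h : MuOneSignAtThree) :
    ∀ (W : WeierstrassCurve ℚ) [W.IsElliptic] [W.IsGloballyMinimal],
    (haveI : Fact (3 : ℕ).Prime := ⟨Nat.prime_three⟩; ClassX7 W 3) → ¬ W.HasCM → W.frobeniusTrace 3 = 0 →
    ∀ [NeZero (W.conductorNorm ℤ)] (f : CuspForm (Gamma0 (W.conductorNorm ℤ)) 2),
    IsNewformOf W f → haveI : Fact (3 : ℕ).Prime := ⟨Nat.prime_three⟩;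
      ∃ (ε₀ : ℤˣ) (L₀ : IwasawaAlgebra 3), IsSignedPAdicLFunction f 3 ε₀ L₀ ∧ HasUnitContent L₀ := by
  intro W _ _ hX _ hap _ f hf
  exact h W hX.1.1 hap f hf

end Summit.BirchSwinnertonDyer.BirchSwinnertonDyer.Cruxes.KobayashiMainConjectureSmallImage.EGCoset
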